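import Mathlib
import HarnessLib.Audit
import Summits.PneNP.PneNP.Theorems.PstarTerminalPeelableResidual
import Summits.PneNP.PneNP.Theorems.PstarChordReadSlackTwoFour

/-!
# O1 up to fourteen outputs: the typed residual node H₁₄ (ROUND-24, O1; memo g22 §24)

FRONTIER range-avoidance ladder, rung F-N3, ROUND 24 (cell `pnp-ideate`, prover-2 memo `g22/O1-PAIRCORE-g22.md` §24; typed target
`PstarCoreBoundTargets.TerminalPeelable` (p646951); restricted-model proof complexity — nothing here bears on `P` versus `NP`).

`PstarChordReadSlackTwoFour.peelable_of_card_le_fourteen` proves `TerminalPeelable` (O1) for every terminal core of at most FOURTEEN outputs from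
the genericity statements H₁₂, H₁₃ (`PstarTerminalPeelableResidual`) and

* `FourGenericFourteen` (H₁₄, OPEN): every fourteen-output terminal core with `#bdry ≤ 22` (automatic with a centre cycle:
  `PstarChordReadSlackTwoFour.slackTwo_of_centre_fourteen`) carrying a centre cycle has FOUR distinct slice-generic chords (such cores have at least
  eight chords);
* **`terminalPeelable_le_fourteen`** — `TwoGenericTwelve → ThreeGenericThirteen → FourGenericFourteen → (O1 for #J₀ ≤ 14)`.

Pattern (memo §24): `t + 2` slice-generic chords kill a terminal core of boundary slack `t = 2·#bdry − 3·#J₀` (`t = 0, 1, 2` in the kernel: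
`PstarChordReadTwoChords`, `PstarChordReadSlackOne`, `PstarChordReadSlackTwoFour`).  No Assumption A.
-/

set_option linter.dupNamespace false -- `Summit.PneNP.PneNP.…`: summit = sub-problem name (D-0017 single-conjunct layout)

open Finset Literature.Computability.Complexity
open Summit.PneNP.PneNP.Theorems.PstarTyped (Typed)
open Summit.PneNP.PneNP.Theorems.PstarSALevel (bdry BoundaryExpanding SimpleOverlap)
open Summit.PneNP.PneNP.Theorems.PstarXCore (xverts)
open Summit.PneNP.PneNP.Theorems.PstarChordRepair (IsChord)
open Summit.PneNP.PneNP.Theorems.PstarCoreBoundTargets (Terminal nonchords)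
open Summit.PneNP.PneNP.Theorems.PstarChordBridgeTools (xpdeg)
open Summit.PneNP.PneNP.Theorems.PstarChordBridgeCotree (Peelable)
open Summit.PneNP.PneNP.Theorems.PstarChordReadLemma (SliceGeneric)
open Summit.PneNP.PneNP.Theorems.PstarTerminalPeelableResidual (TwoGenericTwelve ThreeGenericThirteen)
open Summit.PneNP.PneNP.Theorems.PstarChordReadSlackTwoFour (peelable_of_card_le_fourteen)

namespace Summit.PneNP.PneNP.Theorems.PstarTerminalPeelableFourteen

/-- **H₁₄ (OPEN): four slice-generic chords on every fourteen-output centre structure.**  For every terminal core with `#J₀ = 14`, boundary slack at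
most two (`2·#bdry J₀ ≤ 3·#J₀ + 2`, automatic with a centre cycle) and a centre cycle, there are four distinct slice-generic chords.  FRONTIER. -/
@[conjecture] def FourGenericFourteen : Prop :=
  ∀ (n m r : ℕ) (I : LocalMap 4 n m), I.IsPure xorAndPred → Typed I → SimpleOverlap I → BoundaryExpanding r I →
    ∀ (y : Fin m → Bool) (J₀ : Finset (Fin m)) (w₁ w₂ : Finset (Fin n) × Finset (Fin m) × Bool), Terminal I r y J₀ w₁ w₂ →
      J₀.card = 14 → 2 * (bdry I J₀).card ≤ 3 * J₀.card + 2 →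
      (∃ S ⊆ J₀, S.Nonempty ∧ (∀ w ∈ xverts I S, 2 ≤ xpdeg I S w) ∧ ∀ f ∈ S, ¬ IsChord I J₀ f) →
      ∃ c₁ ∈ J₀, ∃ c₂ ∈ J₀, ∃ c₃ ∈ J₀, ∃ c₄ ∈ J₀, c₁ ≠ c₂ ∧ c₁ ≠ c₃ ∧ c₁ ≠ c₄ ∧ c₂ ≠ c₃ ∧ c₂ ≠ c₄ ∧ c₃ ≠ c₄ ∧
        IsChord I J₀ c₁ ∧ IsChord I J₀ c₂ ∧ IsChord I J₀ c₃ ∧ IsChord I J₀ c₄ ∧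
        SliceGeneric I y J₀ c₁ (w₁.2.1 ∪ w₂.2.1) ∧ SliceGeneric I y J₀ c₂ (w₁.2.1 ∪ w₂.2.1) ∧ SliceGeneric I y J₀ c₃ (w₁.2.1 ∪ w₂.2.1) ∧
        SliceGeneric I y J₀ c₄ (w₁.2.1 ∪ w₂.2.1)

/-- **O1 FOR TERMINAL CORES OF AT MOST FOURTEEN OUTPUTS from H₁₂, H₁₃ and H₁₄.** -/
theorem terminalPeelable_le_fourteen (h₁₂ : TwoGenericTwelve) (h₁₃ : ThreeGenericThirteen) (h₁₄ : FourGenericFourteen) :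
    ∀ (n m r : ℕ) (I : LocalMap 4 n m), I.IsPure xorAndPred → Typed I → SimpleOverlap I → BoundaryExpanding r I →
      ∀ (y : Fin m → Bool) (J₀ : Finset (Fin m)) (w₁ w₂ : Finset (Fin n) × Finset (Fin m) × Bool), Terminal I r y J₀ w₁ w₂ →
        J₀.card ≤ 14 → Peelable I (nonchords I J₀) :=
  fun n m r I hI hT hS hB _ _ _ _ ht hk =>
    peelable_of_card_le_fourteen hI hT hS hB (h₁₂ n m r I hI hT hS hB) (h₁₃ n m r I hI hT hS hB) (h₁₄ n m r I hI hT hS hB) ht hk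

end Summit.PneNP.PneNP.Theorems.PstarTerminalPeelableFourteen
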